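import Summits.BirchSwinnertonDyer.BirchSwinnertonDyer.Theorems.ResidualThetaTransportAtTwoRlfTwistedUniformExponentNondeg
import HarnessLib

/-!
# Road T for item 23110, brick (R3-PT): the EVENTUAL level-`ℚ` signed lift with prescribed class at `2` MODULO the signed local
# Kummer condition (`LIFT-ℚ⁺_ev`) from Poitou–Tate — the global half of LIFT⁺₂(u)

Route `ResidualThetaTransportAtTwo` (RTT, crux r201 `ResidualLambdaFormulaNegDiscAtTwo`, stmt-BirchSwinnertonDyer-23110) /
`ThetaPartnerAtTwo` (TP2). Seat `prover-bsd-wall-tp2-p2x` g12 LEAD (`--supports stmt-BirchSwinnertonDyer-23110`). THEOREMS ONLY (no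
definition, no named fact, no `sorry`); closes nothing by itself.

Greenberg (LNM 1716, §4 Lemma 4.6 (p. 107) with Prop. 4.13 and its Remark, pp. 120–124): a class of `H¹(F_Σ/F_∞, A_s)` whose image under
`ψ = u·conj_γ − 1` is a local coboundary is corrected by a class restricted from level `F` with PRESCRIBED LOCAL BEHAVIOUR AT `p` — the input
`hlift` (LIFT⁺₂) of `SignedEC.TwistedSurj.rlf2_of_twistedDescent`. Its global half at finite level is the following Poitou–Tate statement,
proved here EXACTLY like the eventual Cassels lift (`…RlfTwistedEventualLiftOfPoitouTate`), with the pair of structures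
`𝓖^A ≤ 𝓖_rel` (`W.twistedSignedRelaxedSelmerStructure … A` ≤ t42's `W.twistedRelaxedSelmerStructure`: they differ only at `v ∣ p`,
signed local Kummer condition vs everything), whose `SelmerComplement` prescribes the local class at `v ∣ p` MODULO the signed local Kummer
condition — the exact prescription being impossible (the local condition at `p` has corank `2`, the global group corank `1`):

* `exists_mem_selmerGroup_relaxed_res_sub_mem_localKummer_of_poitouTate` — for every `J` and local classes `x₂(v) ∈ H¹(Γ_{K_v}, E[p^J](χ_u))`
  (`v ∣ p`): some `J' ≥ J` and `x ∈ H¹(K_Σ/K, E[p^{J'}](χ_u))` (`= H¹_{𝓖_rel}`) with `res_v x − H¹(ι) x₂(v) ∈ twistedTorsionLocalKummer … (A v)` at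
  every `v ∣ p` — from `poitouTate_selmerStructure_duality K` and the SAME tower input `htower` as the Cassels lift (the dual Selmer group of
  `𝓖^A` is contained in that of `𝓕^A`);
* `twistedTorsionToH1_mem_unramifiedOutside_of_mem_selmerGroup_relaxed` — read over `K_∞`: `twistedTorsionToH1 x ∈ unramifiedOutside (ker κ) E[p^∞] p S₀`;
* **`liftPlusEventual_two_of_plusDualNondeg_of_eigen`** — `LIFT-ℚ⁺_ev(u)` at `ℚ`, `p = 2` from `hdual` + `hfinE` alone: the global input of
  w3's LIFT⁺₂ assembly (`…RlfTwistedPlusLocEngine.exists_twistedTorsion_localLift_plusKummer_two` supplies the local class `x₂` at `2`;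
  NOTE the prescription is modulo `twistedTorsionLocalKummer`, so the local engine must be consumed in the «`res_2 y − x ∈ L⁺`» form).

HONEST FRAMING: closes nothing; `hdual` (Kim 2007 Prop. 3.18 read at 2, twisted, level ℚ) and `hfinE` are NOT proved here; 23110 is NOT proved;
BSD is not proved by any of this. References: [GreenbergLNM1716] §4 Lemma 4.6 (p. 107), Prop. 4.13 + Remark (pp. 120–122), p. 124;
[Howard2004HeegnerKolyvagin] Thm. 2.1.11; [Kobayashi2003] Def. 1.1.
-/

-- the Theorems namespace of this sub repeats the summit name by design (D-0017 nested layout)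
set_option linter.dupNamespace false

noncomputable section

open scoped Classical NumberField

open NumberField IsDedekindDomain Field
open Literature.NumberTheory.EllipticCurves Literature.NumberTheory.GaloisRepresentations
  Literature.NumberTheory.GaloisCohomology WeierstrassCurve ZpExtension Literature.NumberTheory.EllipticCurves.Kobayashi2003
  Literature.NumberTheory.EllipticCurves.GreenbergVatsal2000
open Literature.NumberTheory.GaloisRepresentations.DiscreteGaloisModule (localTatePairingZMod unramifiedSubgroup
  SelmerStructure TateDual tateDual)

namespace Summit.BirchSwinnertonDyer.BirchSwinnertonDyer.Theorems.SignedEC.TwistedPT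

section Generic

universe u

variable {K : Type u} [Field K] [NumberField K] (W : WeierstrassCurve K) (p : ℕ) [Fact p.Prime]
  (S₀ : Finset (HeightOneSpectrum (𝓞 K))) (κ : ZpExtension K p) (u : ℤ) (hu : (p : ℤ) ∣ u - 1)
  (A : ∀ v : HeightOneSpectrum (𝓞 K), AddSubgroup (localPoints W (v.adicCompletion K)))

/-- `𝓖^A ≤ 𝓖_rel`: the signed relaxed structure is below t42's fully relaxed structure (they differ only at `v ∣ p`, `v ∉ S₀`).
[cite: Howard2004HeegnerKolyvagin, Def. 2.1.10] -/
theorem twistedSignedRelaxedSelmerStructure_le_twistedRelaxed (J : ℕ) :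
    W.twistedSignedRelaxedSelmerStructure p S₀ κ J u hu A ≤ W.twistedRelaxedSelmerStructure p S₀ κ J u hu := by
  intro v
  cases v with
  | inl w => exact le_of_eq (by rw [W.twistedSignedRelaxedSelmerStructure_inl]; rfl)
  | inr v =>
    by_cases hv : v ∈ S₀
    · rw [W.twistedRelaxedSelmerStructure_inr_of_mem p S₀ κ J u hu hv]; exact le_top
    · by_cases hpv : ((p : ℕ) : 𝓞 K) ∈ v.asIdeal
      · rw [W.twistedRelaxedSelmerStructure_inr_of_mem_asIdeal p S₀ κ J u hu hpv]; exact le_top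
      · rw [W.twistedSignedRelaxedSelmerStructure_inr_of_not_mem p S₀ κ J u hu A hv hpv,
          W.twistedRelaxedSelmerStructure_inr_of_not_mem p S₀ κ J u hu hv hpv]

/-- **The EVENTUAL Poitou–Tate lifting with prescribed class at `v ∣ p` MODULO the signed local Kummer condition.** Same inputs as
`exists_mem_selmerGroup_signedRelaxed_res_eq_map_incl_of_poitouTate'` (including the SAME tower input for the dual signed Selmer groups of
`𝓕^A`); for every `J` and local classes `x₂(v)`, `v ∣ p`: some `J' ≥ J` and `x ∈ H¹_{𝓖_rel}(K, E[p^{J'}](χ_u)) = H¹(K_Σ/K, ·)` with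
`res_v x − H¹(ι) x₂(v) ∈ twistedTorsionLocalKummer … (A v)` at every `v ∣ p`. [cite: GreenbergLNM1716, §4 Lemma 4.6 (p. 107), Prop. 4.13 Remark (p. 122), p. 124]
[cite: Howard2004HeegnerKolyvagin, Thm. 2.1.11 (arXiv:1202.6340 p. 6)] -/
theorem exists_mem_selmerGroup_relaxed_res_sub_mem_localKummer_of_poitouTate
    [hfin : ∀ J : ℕ, Finite (W.geomTorsion ((p ^ J : ℕ) : ℤ))]
    (hPT : poitouTate_selmerStructure_duality K) (hS₀ : ∀ v ∈ S₀, ((p : ℕ) : 𝓞 K) ∉ v.asIdeal)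
    (hS : ∀ (J : ℕ) (v : HeightOneSpectrum (𝓞 K)), (Sum.inr v : Place K) ∉ twistedDescentPlaces (K := K) p S₀ →
      ((p ^ J : ℕ) : 𝓞 K) ∉ v.asIdeal ∧ GaloisRep.IsUnramifiedAt v (W.twistedTorsionGaloisModule p κ J u hu))
    (htower : ∀ J : ℕ, ∃ (J' : ℕ) (hJ : J ≤ J'), ∀ inv : LocalInvariants K (p ^ J'), inv.IsPerfect →
      inv.SumLocalTermEqZero → inv.UnramifiedOrthogonal →
      ∀ y ∈ (inv.dualSelmerStructure (W.twistedTorsionGaloisModule p κ J' u hu)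
          (W.twistedSignedSelmerStructure p S₀ κ J' u hu A)).selmerGroup,
        galoisCohomology.map (W.twistedTorsionInclDual p κ hJ u hu) 1 y = 0)
    (J : ℕ) (x₂ : ∀ v : HeightOneSpectrum (𝓞 K),
      galoisCohomology ((W.twistedTorsionGaloisModule p κ J u hu).restrictField (v.adicCompletion K)) 1) :
    ∃ (J' : ℕ) (hJ : J ≤ J') (x : galoisCohomology (W.twistedTorsionGaloisModule p κ J' u hu) 1),
      x ∈ (W.twistedRelaxedSelmerStructure p S₀ κ J' u hu).selmerGroup ∧
      ∀ v : HeightOneSpectrum (𝓞 K), ((p : ℕ) : 𝓞 K) ∈ v.asIdeal →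
        galoisCohomology.res (W.twistedTorsionGaloisModule p κ J' u hu) (v.adicCompletion K) 1 x -
            galoisCohomology.map ((W.twistedTorsionIncl p κ hJ u hu).restrictField (v.adicCompletion K)) 1 (x₂ v) ∈
          W.twistedTorsionLocalKummer p κ J' u hu (v.adicCompletion K) (A v) := by
  obtain ⟨J', hJ, hy⟩ := htower J
  haveI : NeZero (p ^ J') := ⟨pow_ne_zero _ (Fact.out : p.Prime).ne_zero⟩
  obtain ⟨inv, hperf, hvan, hur, hSC⟩ := hPT (p ^ J')
  have hM : ∀ m : W.geomTorsion ((p ^ J' : ℕ) : ℤ), (p ^ J') • m = 0 := W.pow_nsmul_geomTorsion_pow p J'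
  -- the target family: `H¹(ι) x₂(v)` at `v ∣ p` outside `S₀`, `0` elsewhere
  let t' : Π v : Place K, galoisCohomology ((W.twistedTorsionGaloisModule p κ J' u hu).toLocal v) 1 := fun v ↦
    match v with
    | Sum.inl _ => 0
    | Sum.inr v =>
        if ((p : ℕ) : 𝓞 K) ∈ v.asIdeal then
          (galoisCohomology.map ((W.twistedTorsionIncl p κ hJ u hu).restrictField (Place.Completion (K := K) (Sum.inr v)))
            1 (x₂ v) : galoisCohomology ((W.twistedTorsionGaloisModule p κ J' u hu).toLocal (Sum.inr v)) 1)
        else 0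
  have ht'inl : ∀ w : InfinitePlace K, t' (Sum.inl w) = 0 := fun _ ↦ rfl
  have ht'inr : ∀ v : HeightOneSpectrum (𝓞 K), t' (Sum.inr v) = if ((p : ℕ) : 𝓞 K) ∈ v.asIdeal then
      (galoisCohomology.map ((W.twistedTorsionIncl p κ hJ u hu).restrictField (Place.Completion (K := K) (Sum.inr v)))
        1 (x₂ v) : galoisCohomology ((W.twistedTorsionGaloisModule p κ J' u hu).toLocal (Sum.inr v)) 1) else 0 :=
    fun _ ↦ rfl
  have ht' : ∀ v ∈ twistedDescentPlaces (K := K) p S₀, t' v ∈ W.twistedRelaxedSelmerStructure p S₀ κ J' u hu v := by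
    intro v hv
    rw [W.twistedRelaxedSelmerStructure_eq_top_of_mem p S₀ κ J' u hu hv]
    exact AddSubgroup.mem_top _
  -- the dual Selmer group of `𝓖^A` lies in that of `𝓕^A`
  have hdualle : (inv.dualSelmerStructure (W.twistedTorsionGaloisModule p κ J' u hu)
        (W.twistedSignedRelaxedSelmerStructure p S₀ κ J' u hu A)).selmerGroup ≤
      (inv.dualSelmerStructure (W.twistedTorsionGaloisModule p κ J' u hu)
        (W.twistedSignedSelmerStructure p S₀ κ J' u hu A)).selmerGroup := by
    intro y hy'
    rw [SelmerStructure.mem_selmerGroup_iff] at hy' ⊢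
    exact fun v ↦ LocalInvariants.dualSelmerStructure_anti inv _
      (W.twistedSignedSelmerStructure_le_relaxed p S₀ κ J' u hu A) v (hy' v)
  -- orthogonality to the dual Selmer group of `𝓖^A`: adjunction + the tower input
  have horth : ∀ y ∈ (inv.dualSelmerStructure (W.twistedTorsionGaloisModule p κ J' u hu)
      (W.twistedSignedRelaxedSelmerStructure p S₀ κ J' u hu A)).selmerGroup,
      ∑ v ∈ twistedDescentPlaces (K := K) p S₀,
        localTatePairingZMod (W.twistedTorsionGaloisModule p κ J' u hu) (p ^ J') v (inv v) (t' v)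
          (galoisCohomology.localization ((W.twistedTorsionGaloisModule p κ J' u hu).tateDual (p ^ J')) v 1 y) = 0 := by
    intro y hy'
    have hy0 := hy inv hperf hvan hur y (hdualle hy')
    refine Finset.sum_eq_zero fun v _ ↦ ?_
    cases v with
    | inl w => rw [ht'inl, map_zero, AddMonoidHom.zero_apply]
    | inr v =>
      by_cases hpv : ((p : ℕ) : 𝓞 K) ∈ v.asIdeal
      · have hnat : galoisCohomology.map ((W.twistedTorsionInclDual p κ hJ u hu).restrictField
              (Place.Completion (K := K) (Sum.inr v))) 1
            (galoisCohomology.localization ((W.twistedTorsionGaloisModule p κ J' u hu).tateDual (p ^ J'))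
              (Sum.inr v) 1 y) =
            galoisCohomology.localization ((W.twistedTorsionGaloisModule p κ J u hu).tateDual (p ^ J')) (Sum.inr v) 1
              (galoisCohomology.map (W.twistedTorsionInclDual p κ hJ u hu) 1 y) :=
          (galoisCohomology.res_map_one _ _ y).symm
        rw [ht'inr, if_pos hpv, W.localTatePairingZMod_map_twistedTorsionIncl p κ hJ u hu (Sum.inr v) (inv (Sum.inr v)),
          hnat, hy0, map_zero, map_zero]
      · have h0 : t' (Sum.inr v) = 0 := by rw [ht'inr, if_neg hpv]; rfl
        rw [h0, map_zero, AddMonoidHom.zero_apply]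
  obtain ⟨x, hx, hxt⟩ := (hSC (W.twistedTorsionGaloisModule p κ J' u hu) hM (twistedDescentPlaces (K := K) p S₀)
    (hS J') (W.twistedSignedRelaxedSelmerStructure p S₀ κ J' u hu A) (W.twistedRelaxedSelmerStructure p S₀ κ J' u hu)
    (twistedSignedRelaxedSelmerStructure_le_twistedRelaxed W p S₀ κ u hu A J')
    (W.isUnramifiedOutside_twistedSignedRelaxedSelmerStructure p S₀ κ J' u hu A)
    (W.isUnramifiedOutside_twistedRelaxedSelmerStructure p S₀ κ J' u hu)).1 t' ht' horth
  refine ⟨J', hJ, x, hx, fun v hpv ↦ ?_⟩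
  have hv : v ∉ S₀ := fun h ↦ hS₀ v h hpv
  have h := hxt (Sum.inr v) ((inr_mem_twistedDescentPlaces_iff p S₀ v).2 (Or.inr hpv))
  rw [ht'inr, if_pos hpv, W.twistedSignedRelaxedSelmerStructure_inr_of_mem_asIdeal p S₀ κ J' u hu A hv hpv] at h
  exact h

/-- A class of `H¹_{𝓖_rel}(K, E[p^J](χ_u))` read over `K_∞`: `twistedTorsionToH1 x ∈ unramifiedOutside (ker κ) E[p^∞] p S₀`
(t42's `res_mem_unramifiedSubgroup_of_mem_selmerGroup_relaxed` + `MultTransportTwistedDescent.twistedTorsionToH1_mem_unramifiedOutside`).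
[cite: GreenbergLNM1716, §4 pp. 107, 124] -/
theorem twistedTorsionToH1_mem_unramifiedOutside_of_mem_selmerGroup_relaxed {J : ℕ}
    {x : galoisCohomology (W.twistedTorsionGaloisModule p κ J u hu) 1}
    (hx : x ∈ (W.twistedRelaxedSelmerStructure p S₀ κ J u hu).selmerGroup) :
    W.twistedTorsionToH1 p κ J u hu x ∈
      unramifiedOutside κ.kerSubgroup ↥(W.geomPrimaryTorsion p) p (↑S₀ : Set (HeightOneSpectrum (𝓞 K))) :=
  MultTransportTwistedDescent.twistedTorsionToH1_mem_unramifiedOutside W p κ J u hu _ x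
    (fun _ hv hpv ↦ W.res_mem_unramifiedSubgroup_of_mem_selmerGroup_relaxed p S₀ κ J u hu hx
      (fun h ↦ hv (Finset.mem_coe.2 h)) hpv)

end Generic

/-! ## `K = ℚ`, `p = 2`: the tower input and `LIFT-ℚ⁺_ev(u)` from the `±`-duality and the eigen-exponent alone -/

/-- **`LIFT-ℚ⁺_ev(u)` at `ℚ`, `p = 2`, from the `±`-duality and the eigen-exponent alone**: for every level `J` and local classes `x₂(v)` at
the places `v ∋ 2`, some `J' ≥ J` and `x ∈ H¹(Γ_ℚ, E[2^{J'}](χ_u))` with `twistedTorsionToH1 x ∈ H¹(ℚ_Σ/ℚ_∞, E[2^∞]) = unramifiedOutside S₀` and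
`res_v x − H¹(ι) x₂(v)` in the signed local Kummer condition at every `v ∋ 2` — the global input of LIFT⁺₂(u) (w3's local engine
`exists_twistedTorsion_localLift_plusKummer_two` supplies `x₂`). [cite: GreenbergLNM1716, §4 Lemma 4.6 (p. 107), p. 124] -/
theorem liftPlusEventual_two_of_plusDualNondeg_of_eigen (E : WeierstrassCurve ℚ) [E.IsElliptic] [E.IsGloballyMinimal]
    (hss : Rank1Residual.GoodSS E 2) (S₀ : Finset (HeightOneSpectrum (𝓞 ℚ))) (κ : ZpExtension ℚ 2)
    {γ : Field.absoluteGaloisGroup ℚ} (hγ : κ.IsTopGenerator γ) (u : ℤ) (hu : (2 : ℤ) ∣ u - 1) (ε : ℤˣ)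
    (hS2 : ∀ v ∈ S₀, ((2 : ℕ) : 𝓞 ℚ) ∉ v.asIdeal)
    (hS : ∀ v : HeightOneSpectrum (𝓞 ℚ), ¬ E.HasGoodReductionAt v → v ∈ S₀)
    (hdual : ∀ (J : ℕ) (u' : ℤ) (hu' : (2 : ℤ) ∣ u' - 1) (huu' : ((2 : ℤ) ^ J) ∣ u * u' - 1)
      (e : E.geomTorsion ((2 ^ J : ℕ) : ℤ) → E.geomTorsion ((2 ^ J : ℕ) : ℤ) → AlgebraicClosure ℚ)
      (hμ : ∀ S T, e S T ^ (2 ^ J) = 1) (hadd₁ : ∀ S₁ S₂ T, e (S₁ + S₂) T = e S₁ T * e S₂ T)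
      (hadd₂ : ∀ S T₁ T₂, e S (T₁ + T₂) = e S T₁ * e S T₂)
      (hgal : ∀ (σ : absoluteGaloisGroup ℚ) (S T : E.geomTorsion ((2 ^ J : ℕ) : ℤ)), σ • e S T = e (σ • S) (σ • T))
      (hnondeg : ∀ T, (∀ S, e S T = 1) → T = 0)
      [Finite (E.geomTorsion ((2 ^ J : ℕ) : ℤ))]
      (inv : LocalInvariants ℚ (2 ^ J)), inv.IsPerfect → inv.SumLocalTermEqZero → inv.UnramifiedOrthogonal →
      ∀ (v : HeightOneSpectrum (𝓞 ℚ)), ((2 : ℕ) : 𝓞 ℚ) ∈ v.asIdeal →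
      ∀ y' : galoisCohomology ((E.twistedTorsionGaloisModule 2 κ J u' hu').restrictField (v.adicCompletion ℚ)) 1,
        galoisCohomology.map ((E.twistedWeilDual 2 κ J hu hu' huu' e hμ hadd₁ hadd₂ hgal).restrictField (v.adicCompletion ℚ)) 1 y' ∈
            inv.dualLocalCondition (E.twistedTorsionGaloisModule 2 κ J u hu) (Sum.inr v)
              (E.twistedTorsionLocalKummer 2 κ J u hu (v.adicCompletion ℚ)
                (⨆ n : ℕ, signedLocalPoints κ (v.adicCompletion ℚ) E ε n)) →
        y' ∈ E.twistedTorsionLocalKummer 2 κ J u' hu' (v.adicCompletion ℚ) (⨆ n : ℕ, signedLocalPoints κ (v.adicCompletion ℚ) E ε n))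
    (hfinE : ∃ e : ℕ, ∀ c ∈ unramifiedOutside κ.kerSubgroup ↥(E.geomPrimaryTorsion 2) 2 (↑S₀ : Set (HeightOneSpectrum (𝓞 ℚ))) ⊓
        ⨅ (v : HeightOneSpectrum (𝓞 ℚ)) (_ : ((2 : ℕ) : 𝓞 ℚ) ∈ v.asIdeal) (σ : Field.absoluteGaloisGroup ℚ),
          (localKummerOverOfEmb E 2 κ.kerSubgroup (closureEmb (K := ℚ) (v.adicCompletion ℚ))
            (⨆ n : ℕ, signedLocalPoints κ (v.adicCompletion ℚ) E ε n)).comap (E.conjH1 2 κ.kerSubgroup σ),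
      E.conjH1 2 κ.kerSubgroup γ c = u • c → 2 ^ e • c = 0)
    (J : ℕ) (x₂ : ∀ v : HeightOneSpectrum (𝓞 ℚ),
      galoisCohomology ((E.twistedTorsionGaloisModule 2 κ J u hu).restrictField (v.adicCompletion ℚ)) 1) :
    ∃ (J' : ℕ) (hJ : J ≤ J') (x : galoisCohomology (E.twistedTorsionGaloisModule 2 κ J' u hu) 1),
      E.twistedTorsionToH1 2 κ J' u hu x ∈
          unramifiedOutside κ.kerSubgroup ↥(E.geomPrimaryTorsion 2) 2 (↑S₀ : Set (HeightOneSpectrum (𝓞 ℚ))) ∧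
        ∀ v : HeightOneSpectrum (𝓞 ℚ), ((2 : ℕ) : 𝓞 ℚ) ∈ v.asIdeal →
          galoisCohomology.res (E.twistedTorsionGaloisModule 2 κ J' u hu) (v.adicCompletion ℚ) 1 x -
              galoisCohomology.map ((E.twistedTorsionIncl 2 κ hJ u hu).restrictField (v.adicCompletion ℚ)) 1 (x₂ v) ∈
            E.twistedTorsionLocalKummer 2 κ J' u hu (v.adicCompletion ℚ) (⨆ n : ℕ, signedLocalPoints κ (v.adicCompletion ℚ) E ε n) := by
  haveI hfin : ∀ J : ℕ, Finite (E.geomTorsion ((2 ^ J : ℕ) : ℤ)) := fun J ↦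
    haveI : NeZero (2 ^ J) := ⟨pow_ne_zero _ two_ne_zero⟩
    finite_geomTorsion_of_neZero E (2 ^ J)
  -- the in-tree inputs
  have hPT : poitouTate_selmerStructure_duality ℚ := SchneiderFreeAdditiveX3.PoitouTateReduction.poitouTate_selmerStructure_duality_holds ℚ
  have hdiv : E.zsmul_geomPoints_surjective := E.zsmul_geomPoints_surjective_holds
  have hgood : ∀ v : HeightOneSpectrum (𝓞 ℚ), v ∉ (↑S₀ : Set (HeightOneSpectrum (𝓞 ℚ))) → ((2 : ℕ) : 𝓞 ℚ) ∉ v.asIdeal →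
      E.HasGoodReductionAt v := fun v hv _ ↦ by
    by_contra h; exact hv (Finset.mem_coe.2 (hS v h))
  have hSJ : ∀ (J : ℕ) (v : HeightOneSpectrum (𝓞 ℚ)), (Sum.inr v : Place ℚ) ∉ twistedDescentPlaces (K := ℚ) 2 S₀ →
      ((2 ^ J : ℕ) : 𝓞 ℚ) ∉ v.asIdeal ∧ GaloisRep.IsUnramifiedAt v (E.twistedTorsionGaloisModule 2 κ J u hu) := by
    intro J v hv
    rw [not_mem_twistedDescentPlaces_iff] at hv
    exact E.natCast_pow_not_mem_and_isUnramifiedAt_twistedTorsionGaloisModule 2 κ J u hu hgood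
      (fun h ↦ hv.1 (Finset.mem_coe.1 h)) hv.2
  have hbot := SignedTransportAtTwo.fixedPoints_kerSubgroup_eq_bot_of_goodSS E hss κ
  have hfix : ∀ P : E.geomPrimaryTorsion 2, (∀ h : κ.kerSubgroup, h • P = P) → P = 0 := by
    intro P hP
    have hmem : P ∈ FixedPoints.addSubgroup κ.kerSubgroup (E.geomPrimaryTorsion 2) := by
      rw [FixedPoints.mem_addSubgroup]; exact hP
    rw [hbot] at hmem
    exact (AddSubgroup.mem_bot).mp hmem
  have hfixJ : ∀ (J : ℕ) (T : E.geomTorsion ((2 ^ J : ℕ) : ℤ)),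
      (∀ h : absoluteGaloisGroup ℚ, h ∈ κ.kerSubgroup → h • T = T) → T = 0 := by
    intro J T hT
    have h0 := hfix (AddSubgroup.inclusion
      (Literature.Barriers.BirchSwinnertonDyer.geomTorsion_pow_le_geomPrimaryTorsion E 2 J) T) (fun h ↦ by
        apply Subtype.ext
        rw [primaryComponent.coe_smul, AddSubgroup.coe_inclusion, Subgroup.smul_def, ← AddSubgroup.torsionBy.coe_smul,
          hT h h.2])
    have h1 := congrArg (fun b : E.geomPrimaryTorsion 2 ↦ (b : E.geomPoints)) h0
    simp only [AddSubgroup.coe_inclusion, ZeroMemClass.coe_zero] at h1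
    exact Subtype.ext h1
  -- no twisted invariants in `Hom(ker π, μ)` (Weil pairing)
  have hinv : ∀ (j J : ℕ) (hjJ : j ≤ J) (m : TateDual ℚ (E.geomTorsion ((2 ^ J : ℕ) : ℤ)) (2 ^ J)),
      (∀ (g : absoluteGaloisGroup ℚ) (R : E.geomTorsion ((2 ^ J : ℕ) : ℤ)), E.twistedTorsionMulPow 2 κ hjJ u hu R = 0 →
        ((E.twistedTorsionGaloisModule 2 κ J u hu).tateDual (2 ^ J) g m - m) R = 0) →
      ∀ R : E.geomTorsion ((2 ^ J : ℕ) : ℤ), E.twistedTorsionMulPow 2 κ hjJ u hu R = 0 → m R = 0 := by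
    intro j J hjJ m hm R hR
    rcases Nat.eq_zero_or_pos J with hJ0 | hJpos
    · -- `J = 0`: `E[1] = 0`
      subst hJ0
      have hR0 : R = 0 := Subtype.ext (by
        have h : ((2 ^ 0 : ℕ) : ℤ) • (R : E.geomPoints) = 0 := (Submodule.mem_torsionBy_iff _ _).mp R.2
        simp only [pow_zero, Nat.cast_one, one_smul] at h
        exact h)
      rw [hR0, map_zero]
    obtain ⟨eW, hμ, hadd₁, hadd₂, -, hnondeg, hgal⟩ := WeierstrassCurve.exists_weilPairing_holds E (2 ^ J)
      (le_trans (le_refl 2) (Nat.le_self_pow (by omega) 2)) (by exact_mod_cast pow_ne_zero J two_ne_zero)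
    obtain ⟨u', hu', huu'⟩ := exists_inverse_twist (p := 2) hu J
    exact E.forall_apply_eq_zero_of_tateDual_sub_apply_eq_zero 2 κ hjJ hu hu' huu' eW hμ hadd₁ hadd₂ hgal hnondeg hdiv
      (hfixJ J) m hm R hR
  -- the uniform exponent (D5) and the tower (D4c)
  have hexp := uniformExponent_of_plusDualNondeg_of_eigen E 2 S₀ κ u hu
    (fun v ↦ ⨆ n : ℕ, signedLocalPoints κ (v.adicCompletion ℚ) E ε n)
    hγ hS2 hSJ hfix (fun J u' hu' huu' e hμ hadd₁ hadd₂ hgal hnondeg ↦ hdual J u' hu' huu' e hμ hadd₁ hadd₂ hgal hnondeg) hfinE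
  have htower := E.tower_of_uniform_exponent 2 κ u hu hdiv
    (fun J ↦ E.twistedSignedSelmerStructure 2 S₀ κ J u hu (fun v ↦ ⨆ n : ℕ, signedLocalPoints κ (v.adicCompletion ℚ) E ε n))
    hinv hexp
  obtain ⟨J', hJ, x, hx, hxt⟩ := exists_mem_selmerGroup_relaxed_res_sub_mem_localKummer_of_poitouTate E 2 S₀ κ u hu
    (fun v ↦ ⨆ n : ℕ, signedLocalPoints κ (v.adicCompletion ℚ) E ε n) hPT hS2 hSJ htower J x₂
  exact ⟨J', hJ, x, twistedTorsionToH1_mem_unramifiedOutside_of_mem_selmerGroup_relaxed E 2 S₀ κ u hu hx, hxt⟩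

end Summit.BirchSwinnertonDyer.BirchSwinnertonDyer.Theorems.SignedEC.TwistedPT

end
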